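/-
Copyright (c) 2026 the pub-hodgecm-mathlib formalisation cell (harness21).  Prover seat hodgecm-mathlib-LH1-p03 (g4): line LH1 (chair LH1-plan (g4)),
ED. 5 «QPSI ± 1» read-backs (Q1) «QPSI-GLUE»; 2026-09-02.
-/
import Summits.HodgeConjecture.HodgeConjecture.Theorems.F0P3cS2SharpOrgansOfS2Sharp   -- ★ p848004 ED. 1 certificate (LH1-p01 (g0)): re-exports ★ token existence, ★ U♭-cot rigidity, ★ `K_c`-triviality, ★ arch data of record
import Summits.HodgeConjecture.HodgeConjecture.Theorems.F0P3cPinCompactChi            -- ★ (K1) p850169 (F0P3a-p01 (g19)): letters `S2PinCompactLetter`, `S2CasimirTauLetter`; over ★ (B6) p850069 + ★ O-SPLIT p850109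
import HarnessLib

/-!
# Crux `H413`, half A line LH1 — «QPSI ± 1»: the printed archimedean residue of #80 S2♯ as ONE token-free sentence, and its read-backs
# (S2♯ ⟹ QPSI; QPSI ⟹ PIN ∕ CASIMIR at EVERY archimedean place; S2♭ (#70) ∧ QPSI ⟹ S2♯ (#80)) — THEOREMS ONLY

Cell `hodgecm-mathlib` (D-0151), FLOOR 0, crux item H413 = `stmt-HodgeConjecture-24833`, route of record `HCCMUnconditional` (no route verbs); half A line
LH1 (SEATPLAN-GO500.v1 §1B ∕ §5), prover LH1-p03 (g4) on the DEAL of LH1-plan (g4) 2026-09-02T07:59:49Z («QPSI ± 1» placement) and its 07:58:00Z edition rule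
(«LEAF ED. 5 “QPSI ± 1” — one organ `∀ τ, ξ.qψ τ = ±1` replacing CASIMIR-ι ∧ CASIMIR-τ — admissible ONLY if that sentence is placed literally in print»).
`--supports stmt-HodgeConjecture-24833`.  THEOREMS ONLY (no `def`, no instance, no attribute, no notation, no named fact, no `sorry`); never imports a
`Cruxes/…/Lines` module; no `(𝔤,K)`-token type is spelled in this file (the token of a cotangent `P` is OBTAINED from ★ `exists_cohToken_of_isHolOrAntihol_cpt`).

THE PLACEMENT (memo `F0/P3c/LH1/LH1-p03/g4/QPSI-PLACEMENT.LH1p03g4.md`, sha16 2097acbead4eea17).  [Marshall2014] S. Marshall, *Endoscopy and cohomology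
growth on U(3)*, Compositio Math. 150 (2014) 903–910, §3.3 «Real places» (held `paper:arxiv-1301.7244`, READ EXACT): «For any one-dimensional representation
`ξ` of `H_{v₀}`, the local packet `Π_{v₀}(ξ)` is disjoint from `{J^±}` unless `ξ = (det₀)^{−t_{v₀}−1} λ¹` (case 1) or `ξ = (det₀)^{−t_{v₀}} λ^{−1}` (case 2). In
the remaining two cases, we have `Π_{v₀}(ξ) = {J⁺, D⁻}` in case 1, `{J⁻, D⁺}` in case 2.» and, at the COMPACT places, «`G_v = U(3; ℝ)` … `Π_v(ξ)` is the
trivial representation exactly when `ξ` is either `(det₀)^{−t_v−1} λ¹` or `(det₀)^{−t_v} λ^{−1}`»; §3.4: «any representation `π = ⊗_v π_v ∈ L²_d(G, ω)`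
satisfying `π_{v₀} ≃ J^±` must lie in a packet `Π(ξ)` for some `ξ` ([R1], Theorem 13.3.6)», `Π(ξ) := ⊗_v Π_v(ξ_v)`; §4.1: «`Ξ_∞` := the characters of
`H_∞` that are equal to either `(det₀)^{−t_v−1}λ¹` or `(det₀)^{−t_v}λ^{−1}` at each place `v`».  With `λ` = the `U(1)`-coordinate and `det = det₀·λ`,
Marshall's two characters are `(p, q) = (−t−2, 1)` and `(1−t, −1)` in the tree's `(det₀, det)`-exponents `(ξ.pη, ξ.qψ)` — TOKEN FOR TOKEN the two disjuncts of
★ `ArchSignRecipe.isCohTrivial_iff`; in particular the `det`-exponent `ξ.qψ v = ±1` at EVERY archimedean `v` («QPSI»).  The book carries the same sentence as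
the composite [Rogawski1990, Thm. 13.3.6 (c) (p. 202); §13.3 (global L-packets `Π = ⊗Π_v`); §12.3 p. 178 (`π^n(ξ) = J_φ^±`, `ξ(h) = det₀(h)^{−m−t−1}det(h)^a ∕
det₀(h)^{n−t}det(h)^c`); Prop. 15.2.1 (b) (p. 249); §14.6 pp. 242–243 (`Π′(ξ_v) = {F_φ}` at the compact places) and Thm. 14.6.4 (p. 243); §15.3 ¶1 (p. 249)].

THE SENTENCE AS A LEAN TELESCOPE («QPSI», written out in each theorem; = the frame of the LH1 leaf's PIN-τ ∕ CASIMIR-τ ∕ S2♯ TOKEN FOR TOKEN — compact CM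
frame `(L ι H T hT) hdef h2 (μ) (μω hμu) hμω`, a discrete `P` of (anti)holomorphic cotangent type at the frame, fixed pointwise by `K_c = cmCompactFactor`, and a
one-dimensional automorphic `ξ` of `H` with `MemXiFamily P … μω hμu ξ` — with the conclusion `∀ τ : L →+* ℂ, ξ.qψ τ = 1 ∨ ξ.qψ τ = −1` at EVERY complex
embedding `τ`, the place of `ι` included):
* §1 `qpsi_of_S2sharp : S2♯ → ‹QPSI›` — the new organ is IMPLIED by the closer stub (a RE-CUT of #80, never a strengthening): a cotangent `P` has a `(𝔤,K)`-token
  (★ `F0P3SLayerFoldShapes.exists_cohToken_of_isHolOrAntihol_cpt`), S2♯ yields `ξ₀` pinned at every unitary type of `μω` — at `k₀ = archTypeOfRecord μω`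
  (★ `hasUnitaryArchType_archTypeOfRecord`) and every `τ` —, the given `ξ` is `ξ₀` (★ p847744 `memXiFamily_rigid_of_isCot`), and coh-trivial ⇒ `qψ = ±1`
  (★ (B6) `q_eq_of_isCohTrivial`).
* §2 READ-BACKS of «QPSI» at EVERY embedding, modulo the in-house ★ CENTRAL identity at every place (★ (B6) p850069 over ★ O-SPLIT p850109 `xiCentralCharSplit`):
  `isCohTrivialAt_of_qpsi` (PIN at every `τ`, ι INCLUDED — the `K_c`-triviality «QPSI» asks for HOLDS for a cotangent `P`, ★ p819716
  `cmCompactFactor_rightRegular_eq_self_of_isHolOrAntihol`, so the read-back's frame is token-free AND `K_c`-free), `sq_sum_eq_two_of_qpsi` (CASIMIR at every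
  `τ`: `a²+b²+c² = 2` for every presentation `(a,b,c)` of the Rogawski triple — at `τ = ι` the conclusion of the leaf's CASIMIR-ι, whose token binders are then
  simply unused; at `τ ∤ ι` CASIMIR-τ's), and as ★ (K1) letters `pinCompact_of_qpsi : ‹QPSI› → S2PinCompactLetter`, `casimirTau_of_qpsi : ‹QPSI› → S2CasimirTauLetter`.
* §3 `s2sharp_of_S2flat_qpsi : S2♭ → ‹QPSI› → S2♯` — books #80 = books #70 (its finite-place half, ★ letter `cohDiscrete_memXiFamily`) + «QPSI» (its archimedean
  half, now ONE printed sentence): the `ξ` of S2♭; a unitary type `k` of `μω` IS `k₀` (★ `archTypeOfRecord_eq`); the pin at every `ι′` is §2's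
  `isCohTrivialAt_of_qpsi`.  (The leaf's FIN is S2♭ restricted to the S2♯ frame — ★ leaf §4 `s2Fin_of_S2flat`; the FIN-form of §3 is the leaf heir's three-line
  head edit, see USE below — FIN's text carries the token type and is ★ (C4)'s `S2FinLetter`, not restated here.)
USE (for LH1-plan's heir, LEAF ED. 5): organ `stub_S2qpsi : ‹QPSI›` [cite: Marshall2014 §3.3, §3.4, §4.1; Rogawski1990 Thm. 13.3.6 (c), §13.3, §12.3 p. 178, Thm.
14.6.4, §15.3 ¶1]; then `stub_S2casimirIota := fun L _ _ _ ι H T hT hdef h2 μ _ μω hμu hμω P hP M _ _ σK σ𝔤 hM hirr htok ξ hmem a b c habc =>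
sq_sum_eq_two_of_qpsi stub_S2qpsi L ι H T hT hdef h2 μ μω hμu hμω P hP ξ hmem ι a b c habc` and `stub_S2casimirTau := casimirTau_of_qpsi stub_S2qpsi` (ED. 4's
composition kept verbatim; sorries 3 → 2 = FIN + QPSI), OR the direct head `⟨ξ, hmem, fun k hk ι′ => (archTypeOfRecord_eq hμu hk) ▸ isCohTrivialAt_of_qpsi stub_S2qpsi … ι′⟩`.
EDITION: ED. 2 (DOCSTRING-ONLY, 2026-09-02, LH1-p03 (g4)): Rogawski locators corrected — Thm. 13.3.5 ∕ Thm. 13.3.6 (c) are on p. 202 (as in the tree's letters) and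
§13.3's definition of global L-packets (`Π = ⊗_v Π_v`) is cited by section; the held copies of [Rogawski1990] are 3000-character CHUNKS, not pages (chunk
p0195 ≠ p. 200 — ED. 1 (p850418) misread it).  All declarations, statements and proofs are byte-identical to ED. 1.
Nothing printed is discharged here.  HONEST LABEL: HC_CM is proved only modulo the 7 printed citations (2 remaining: hLiu418 = stmt-HodgeConjecture-24832,
h413 = stmt-HodgeConjecture-24833) until rung 0 closes; count-neutral.

## References
* [Marshall2014] S. Marshall, *Endoscopy and cohomology growth on U(3)*, Compositio Math. 150 (2014) 903–910 (arXiv:1301.7244): §3.3 «Real places», §3.4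
  «Global packets», §4.1 (the set `Ξ_∞`).
* [Rogawski1990] J. D. Rogawski, *Automorphic Representations of Unitary Groups in Three Variables*, Ann. of Math. Stud. 123 (1990): §12.3 pp. 174–178
  (`μ(z) = (z∕z̄)^{t+1∕2}` p. 174; the table `π^n(ξ)`, `ξ(h)` p. 178); §13.3 (global L-packets `Π = ⊗Π_v`; Thm. 13.3.5 and Thm. 13.3.6 (c), p. 202); §14.6 pp. 242–243
  (`Π′(ξ_v) := {F_φ}`), Thm. 14.6.4 (p. 243); Prop. 15.2.1 (b) and §15.3 ¶1 (p. 249).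
* [DimitrovRamakrishnan2015] M. Dimitrov, D. Ramakrishnan, *Arithmetic quotients of the complex ball and a conjecture of Lang*, Doc. Math. 20 (2015), proof of
  Thm. 3.2 (p. 9: «(h, u) → det(h)^{r−t} u^s … r = −1 and s = 1 … (a, b, c) = (1, 0, −1)») — the forward direction, citing [Rogawski1992, p. 397].
* Tree: ★ ED. 1 Cert `Theorems/F0P3cS2SharpOrgansOfS2Sharp` (p848004), ★ (K1) `Theorems/F0P3cPinCompactChi` (p850169), ★ (B6) `Theorems/F0P3cXiCentralAllPlaces` (p850069),
  ★ O-SPLIT `Theorems/F0P3cXiCentralCharSplit` (p850109), ★ p847744, ★ p819716, ★ `F0P3SLayerFoldShapes`, ★ `F0P3XiArchDataOfRecord`.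
-/

set_option autoImplicit false
-- the mandated namespace has the single-problem summit's repeated segment (`HodgeConjecture.HodgeConjecture`)
set_option linter.dupNamespace false

noncomputable section

open NumberField IsDedekindDomain MeasureTheory
open scoped Matrix ComplexOrder

namespace Summit.HodgeConjecture.HodgeConjecture.Cruxes.H413.F0P3cS2SharpQpsi

open Literature.NumberTheory.Automorphic Literature.NumberTheory.Automorphic.UnitaryGroup
open Literature.NumberTheory.Automorphic.UnitaryGroup.CotangentForms
open Literature.NumberTheory.GaloisRepresentations
open Literature.NumberTheory.Rogawski1990
open Summit.HodgeConjecture.HodgeConjecture.Cruxes.H413.F0P3XiArchDataOfRecord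
open Summit.HodgeConjecture.HodgeConjecture.Cruxes.H413.F0P3cMemXiFamilyRigidOfCot (memXiFamily_rigid_of_isCot)
open Summit.HodgeConjecture.HodgeConjecture.Cruxes.H413.F0P3CompactTrivOfRecord (cmCompactFactor_rightRegular_eq_self_of_isHolOrAntihol)
open Summit.HodgeConjecture.HodgeConjecture.Cruxes.H413.F0P3SLayerFoldShapes (exists_cohToken_of_isHolOrAntihol_cpt)
open Summit.HodgeConjecture.HodgeConjecture.Cruxes.H413.F0P3cXiCentralIotaOfOrgans (XiCentralCharSplitLetter)
open Summit.HodgeConjecture.HodgeConjecture.Cruxes.H413.F0P3cXiCentralAllPlaces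
open Summit.HodgeConjecture.HodgeConjecture.Cruxes.H413.F0P3cXiCentralCharSplit (xiCentralCharSplit)
open Summit.HodgeConjecture.HodgeConjecture.Cruxes.H413.F0P3cPinCompactChi (S2PinCompactLetter S2CasimirTauLetter)

/-! ## §1 S2♯ ⟹ «QPSI» (the organ of LEAF ED. 5 is a re-cut of #80, not a strengthening) -/

/-- **S2♯ ⟹ «QPSI ± 1»**: at the compact CM frame, for a discrete `P` of (anti)holomorphic cotangent type fixed pointwise by `K_c` and EVERY one-dimensional
automorphic `ξ` of `H` with `MemXiFamily P … μω hμu ξ`, the `det`-exponent of `ξ` is `±1` at every complex embedding: `∀ τ, ξ.qψ τ = 1 ∨ ξ.qψ τ = −1`.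
PROOF: a cotangent `P` has a `(𝔤,K)`-token at `ι` of some type `δ = ±1` (★ `exists_cohToken_of_isHolOrAntihol_cpt`); S2♯ yields `ξ₀` with `MemXiFamily P … ξ₀`
pinned at every unitary type of `μω`, in particular at `k₀ = archTypeOfRecord μω` (★ `hasUnitaryArchType_archTypeOfRecord`) and at `τ`; `ξ = ξ₀` by U♭ on the
cotangent locus (★ p847744); coh-trivial at `τ` forces `qψ τ = ±1` (★ `q_eq_of_isCohTrivial`).  In print this is Marshall's sentence read off `P ∈ Π(ξ)`.
[cite: Marshall2014, §3.3; §3.4; §4.1] [cite: Rogawski1990, Thm. 13.3.6 (c) (p. 202); §13.3 (global L-packets); §12.3 p. 178; §14.6 Thm. 14.6.4 (p. 243); §15.3 ¶1 (p. 249)] -/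
theorem qpsi_of_S2sharp (h : Literature.NumberTheory.Rogawski1990.cohDiscrete_memXiFamily_archPinned) :
    ∀ (L : Type) [Field L] [NumberField L] [IsCMField L] (ι : L →+* ℂ) (H : Matrix (Fin 3) (Fin 3) L) (T : GL (Fin 3) ℂ)
      (hT : (T : Matrix (Fin 3) (Fin 3) ℂ)ᴴ * H.map ι * (T : Matrix (Fin 3) (Fin 3) ℂ) = Literature.Geometry.ComplexHyperbolic.BallModel.J),
      (∀ τ' : L →+* ℂ, InfinitePlace.mk τ' ≠ InfinitePlace.mk ι → (H.map τ').PosDef) →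
      2 ≤ Module.finrank ℚ ↥(maximalRealSubfield L) →
      ∀ (μ : Measure (adelicGroupData (↥(maximalRealSubfield L)) L (IsCMField.complexConj L) 3 H).automorphicQuotient)
        [(adelicGroupData (↥(maximalRealSubfield L)) L (IsCMField.complexConj L) 3 H).IsAutomorphicMeasure μ]
        (μω : HeckeCharacter L) (hμu : μω.IsUnitary),
        (∀ x : Literature.NumberTheory.GaloisRepresentations.ideleGroup ↥(maximalRealSubfield L),
          μω (AdeleRing.ideleBaseChange (↥(maximalRealSubfield L)) L x) = quadraticHeckeCharCM L x) →
      ∀ (P : DiscreteAutomorphicRep (adelicGroupData (↥(maximalRealSubfield L)) L (IsCMField.complexConj L) 3 H) μ),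
        (P.IsHolCotangentAt (cmArchSection L ι H T hT) (cmCompactFactor L ι H T hT) ∨
          P.IsAntiholCotangentAt (cmArchSection L ι H T hT) (cmCompactFactor L ι H T hT)) →
        (∀ k : (adelicGroupData (↥(maximalRealSubfield L)) L (IsCMField.complexConj L) 3 H).Adelic, k ∈ cmCompactFactor L ι H T hT →
          ∀ v : P.space.toSubmodule, (adelicGroupData (↥(maximalRealSubfield L)) L (IsCMField.complexConj L) 3 H).rightRegular μ k
            (v : (adelicGroupData (↥(maximalRealSubfield L)) L (IsCMField.complexConj L) 3 H).L2 μ) = v) →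
        ∀ ξ : OneDimAutRepH L,
          MemXiFamily P (transpose_map_cmConjRingHom_eq_of_frame L ι H T hT) (isUnit_det_of_frame L ι H T hT) μω hμu ξ →
            ∀ τ : L →+* ℂ, ξ.qψ τ = 1 ∨ ξ.qψ τ = -1 := by
  intro L _ _ _ ι H T hT hdef h2 μ _ μω hμu hμω P hP hKc ξ hmem τ
  -- S2♯'s missing hypothesis: a cotangent `P` carries a `(𝔤,K)`-token of some type `δ = ±1` at `ι` (★ `exists_cohToken_of_isHolOrAntihol_cpt`)
  obtain ⟨M, _, _, σK, σ𝔤, hM, δ, hδ, hirr, htok, hne⟩ := exists_cohToken_of_isHolOrAntihol_cpt L ι H T hT μ hdef h2 P hP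
  obtain ⟨ξ₀, hmem₀, hall⟩ := h L ι H T hT hdef h2 μ μω hμu hμω P hP hKc M σK σ𝔤 hM hirr htok δ hδ hne
  -- the given `ξ` of the family IS S2♯'s `ξ₀` (U♭ on the cotangent locus, ★ p847744)
  have hξ : ξ = ξ₀ := memXiFamily_rigid_of_isCot ι H T hT hdef h2 μω hμu P hP ξ ξ₀ hmem hmem₀
  rw [hξ]
  exact q_eq_of_isCohTrivial (hall (archTypeOfRecord μω) (hasUnitaryArchType_archTypeOfRecord μω hμu hμω) τ)

/-! ## §2 «QPSI» ⟹ PIN and CASIMIR at EVERY archimedean place (modulo the in-house ★ CENTRAL identity at every place) -/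

/-- **«QPSI» ⟹ PIN at every embedding** (ι INCLUDED; token-free, `K_c`-free frame): for a discrete `P` of (anti)holomorphic cotangent type at the CM frame and every
`ξ` with `MemXiFamily P … μω hμu ξ`, `ξ.IsCohTrivialAt (tOfArchType (archTypeOfRecord μω) τ) τ` at every `τ`.  PROOF: `K_c` fixes a cotangent `P` pointwise
(★ p819716), so «QPSI» gives `qψ τ = ±1`; with the CENTRAL identity at `τ` (★ (B6) `isCohTrivialAt_of_split_of_qψ` over ★ O-SPLIT `xiCentralCharSplit`) this is the
cohomological-weight condition.  At `τ = ι` this is the old PIN-ι (without its token), at `τ ∤ ι` the organ PIN-τ; it is the pin the S2♯ head needs at every `ι′`.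
[cite: Marshall2014, §3.3; §4.1] [cite: Rogawski1990, §12.3 p. 178; Prop. 15.2.1 (b) (p. 249); §14.6 pp. 242–243] -/
theorem isCohTrivialAt_of_qpsi
    (hQ : ∀ (L : Type) [Field L] [NumberField L] [IsCMField L] (ι : L →+* ℂ) (H : Matrix (Fin 3) (Fin 3) L) (T : GL (Fin 3) ℂ)
      (hT : (T : Matrix (Fin 3) (Fin 3) ℂ)ᴴ * H.map ι * (T : Matrix (Fin 3) (Fin 3) ℂ) = Literature.Geometry.ComplexHyperbolic.BallModel.J),
      (∀ τ' : L →+* ℂ, InfinitePlace.mk τ' ≠ InfinitePlace.mk ι → (H.map τ').PosDef) →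
      2 ≤ Module.finrank ℚ ↥(maximalRealSubfield L) →
      ∀ (μ : Measure (adelicGroupData (↥(maximalRealSubfield L)) L (IsCMField.complexConj L) 3 H).automorphicQuotient)
        [(adelicGroupData (↥(maximalRealSubfield L)) L (IsCMField.complexConj L) 3 H).IsAutomorphicMeasure μ]
        (μω : HeckeCharacter L) (hμu : μω.IsUnitary),
        (∀ x : Literature.NumberTheory.GaloisRepresentations.ideleGroup ↥(maximalRealSubfield L),
          μω (AdeleRing.ideleBaseChange (↥(maximalRealSubfield L)) L x) = quadraticHeckeCharCM L x) →
      ∀ (P : DiscreteAutomorphicRep (adelicGroupData (↥(maximalRealSubfield L)) L (IsCMField.complexConj L) 3 H) μ),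
        (P.IsHolCotangentAt (cmArchSection L ι H T hT) (cmCompactFactor L ι H T hT) ∨
          P.IsAntiholCotangentAt (cmArchSection L ι H T hT) (cmCompactFactor L ι H T hT)) →
        (∀ k : (adelicGroupData (↥(maximalRealSubfield L)) L (IsCMField.complexConj L) 3 H).Adelic, k ∈ cmCompactFactor L ι H T hT →
          ∀ v : P.space.toSubmodule, (adelicGroupData (↥(maximalRealSubfield L)) L (IsCMField.complexConj L) 3 H).rightRegular μ k
            (v : (adelicGroupData (↥(maximalRealSubfield L)) L (IsCMField.complexConj L) 3 H).L2 μ) = v) →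
        ∀ ξ : OneDimAutRepH L,
          MemXiFamily P (transpose_map_cmConjRingHom_eq_of_frame L ι H T hT) (isUnit_det_of_frame L ι H T hT) μω hμu ξ →
            ∀ τ : L →+* ℂ, ξ.qψ τ = 1 ∨ ξ.qψ τ = -1)
    (L : Type) [Field L] [NumberField L] [IsCMField L] (ι : L →+* ℂ) (H : Matrix (Fin 3) (Fin 3) L) (T : GL (Fin 3) ℂ)
    (hT : (T : Matrix (Fin 3) (Fin 3) ℂ)ᴴ * H.map ι * (T : Matrix (Fin 3) (Fin 3) ℂ) = Literature.Geometry.ComplexHyperbolic.BallModel.J)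
    (hdef : ∀ τ' : L →+* ℂ, InfinitePlace.mk τ' ≠ InfinitePlace.mk ι → (H.map τ').PosDef)
    (h2 : 2 ≤ Module.finrank ℚ ↥(maximalRealSubfield L))
    (μ : Measure (adelicGroupData (↥(maximalRealSubfield L)) L (IsCMField.complexConj L) 3 H).automorphicQuotient)
    [(adelicGroupData (↥(maximalRealSubfield L)) L (IsCMField.complexConj L) 3 H).IsAutomorphicMeasure μ]
    (μω : HeckeCharacter L) (hμu : μω.IsUnitary)
    (hμω : ∀ x : Literature.NumberTheory.GaloisRepresentations.ideleGroup ↥(maximalRealSubfield L),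
      μω (AdeleRing.ideleBaseChange (↥(maximalRealSubfield L)) L x) = quadraticHeckeCharCM L x)
    (P : DiscreteAutomorphicRep (adelicGroupData (↥(maximalRealSubfield L)) L (IsCMField.complexConj L) 3 H) μ)
    (hP : P.IsHolCotangentAt (cmArchSection L ι H T hT) (cmCompactFactor L ι H T hT) ∨
      P.IsAntiholCotangentAt (cmArchSection L ι H T hT) (cmCompactFactor L ι H T hT))
    (ξ : OneDimAutRepH L)
    (hmem : MemXiFamily P (transpose_map_cmConjRingHom_eq_of_frame L ι H T hT) (isUnit_det_of_frame L ι H T hT) μω hμu ξ)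
    (τ : L →+* ℂ) :
    ξ.IsCohTrivialAt (ArchSignRecipe.tOfArchType (archTypeOfRecord μω) τ) τ :=
  isCohTrivialAt_of_split_of_qψ xiCentralCharSplit L ι H T hT hdef h2 μ μω hμu hμω P hP ξ hmem τ
    (hQ L ι H T hT hdef h2 μ μω hμu hμω P hP (cmCompactFactor_rightRegular_eq_self_of_isHolOrAntihol L ι H T hT P hP) ξ hmem τ)

/-- **«QPSI» ⟹ CASIMIR at every embedding** (ι INCLUDED; token-free, `K_c`-free frame): for the Rogawski triple `(a,b,c) = rogTriple (ξ.pη τ) (ξ.qψ τ) t_τ`,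
`t_τ = tOfArchType (archTypeOfRecord μω) τ`, one has `a² + b² + c² = 2` — at `τ = ι` the conclusion of the leaf's organ CASIMIR-ι (its token binders are not needed),
at `τ ∤ ι` that of CASIMIR-τ.  PROOF: «QPSI» (with ★ p819716 supplying `K_c`-triviality) and ★ (B6) `sq_sum_eq_two_iff_qψ_of_split` (`.mpr`) over ★ O-SPLIT.
[cite: Marshall2014, §3.3; §4.1] [cite: Rogawski1990, §12.3 p. 178; §14.6 pp. 242–243] [cite: BorelWallach2000, II Prop. 6.12 (2)] -/
theorem sq_sum_eq_two_of_qpsi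
    (hQ : ∀ (L : Type) [Field L] [NumberField L] [IsCMField L] (ι : L →+* ℂ) (H : Matrix (Fin 3) (Fin 3) L) (T : GL (Fin 3) ℂ)
      (hT : (T : Matrix (Fin 3) (Fin 3) ℂ)ᴴ * H.map ι * (T : Matrix (Fin 3) (Fin 3) ℂ) = Literature.Geometry.ComplexHyperbolic.BallModel.J),
      (∀ τ' : L →+* ℂ, InfinitePlace.mk τ' ≠ InfinitePlace.mk ι → (H.map τ').PosDef) →
      2 ≤ Module.finrank ℚ ↥(maximalRealSubfield L) →
      ∀ (μ : Measure (adelicGroupData (↥(maximalRealSubfield L)) L (IsCMField.complexConj L) 3 H).automorphicQuotient)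
        [(adelicGroupData (↥(maximalRealSubfield L)) L (IsCMField.complexConj L) 3 H).IsAutomorphicMeasure μ]
        (μω : HeckeCharacter L) (hμu : μω.IsUnitary),
        (∀ x : Literature.NumberTheory.GaloisRepresentations.ideleGroup ↥(maximalRealSubfield L),
          μω (AdeleRing.ideleBaseChange (↥(maximalRealSubfield L)) L x) = quadraticHeckeCharCM L x) →
      ∀ (P : DiscreteAutomorphicRep (adelicGroupData (↥(maximalRealSubfield L)) L (IsCMField.complexConj L) 3 H) μ),
        (P.IsHolCotangentAt (cmArchSection L ι H T hT) (cmCompactFactor L ι H T hT) ∨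
          P.IsAntiholCotangentAt (cmArchSection L ι H T hT) (cmCompactFactor L ι H T hT)) →
        (∀ k : (adelicGroupData (↥(maximalRealSubfield L)) L (IsCMField.complexConj L) 3 H).Adelic, k ∈ cmCompactFactor L ι H T hT →
          ∀ v : P.space.toSubmodule, (adelicGroupData (↥(maximalRealSubfield L)) L (IsCMField.complexConj L) 3 H).rightRegular μ k
            (v : (adelicGroupData (↥(maximalRealSubfield L)) L (IsCMField.complexConj L) 3 H).L2 μ) = v) →
        ∀ ξ : OneDimAutRepH L,
          MemXiFamily P (transpose_map_cmConjRingHom_eq_of_frame L ι H T hT) (isUnit_det_of_frame L ι H T hT) μω hμu ξ →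
            ∀ τ : L →+* ℂ, ξ.qψ τ = 1 ∨ ξ.qψ τ = -1)
    (L : Type) [Field L] [NumberField L] [IsCMField L] (ι : L →+* ℂ) (H : Matrix (Fin 3) (Fin 3) L) (T : GL (Fin 3) ℂ)
    (hT : (T : Matrix (Fin 3) (Fin 3) ℂ)ᴴ * H.map ι * (T : Matrix (Fin 3) (Fin 3) ℂ) = Literature.Geometry.ComplexHyperbolic.BallModel.J)
    (hdef : ∀ τ' : L →+* ℂ, InfinitePlace.mk τ' ≠ InfinitePlace.mk ι → (H.map τ').PosDef)
    (h2 : 2 ≤ Module.finrank ℚ ↥(maximalRealSubfield L))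
    (μ : Measure (adelicGroupData (↥(maximalRealSubfield L)) L (IsCMField.complexConj L) 3 H).automorphicQuotient)
    [(adelicGroupData (↥(maximalRealSubfield L)) L (IsCMField.complexConj L) 3 H).IsAutomorphicMeasure μ]
    (μω : HeckeCharacter L) (hμu : μω.IsUnitary)
    (hμω : ∀ x : Literature.NumberTheory.GaloisRepresentations.ideleGroup ↥(maximalRealSubfield L),
      μω (AdeleRing.ideleBaseChange (↥(maximalRealSubfield L)) L x) = quadraticHeckeCharCM L x)
    (P : DiscreteAutomorphicRep (adelicGroupData (↥(maximalRealSubfield L)) L (IsCMField.complexConj L) 3 H) μ)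
    (hP : P.IsHolCotangentAt (cmArchSection L ι H T hT) (cmCompactFactor L ι H T hT) ∨
      P.IsAntiholCotangentAt (cmArchSection L ι H T hT) (cmCompactFactor L ι H T hT))
    (ξ : OneDimAutRepH L)
    (hmem : MemXiFamily P (transpose_map_cmConjRingHom_eq_of_frame L ι H T hT) (isUnit_det_of_frame L ι H T hT) μω hμu ξ)
    (τ : L →+* ℂ) (a b c : ℤ)
    (habc : ArchSignRecipe.rogTriple (ξ.pη τ) (ξ.qψ τ) (ArchSignRecipe.tOfArchType (archTypeOfRecord μω) τ) = (a, b, c)) :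
    a ^ 2 + b ^ 2 + c ^ 2 = 2 :=
  (sq_sum_eq_two_iff_qψ_of_split xiCentralCharSplit L ι H T hT hdef h2 μ μω hμu hμω P hP ξ hmem τ a b c habc).mpr
    (hQ L ι H T hT hdef h2 μ μω hμu hμω P hP (cmCompactFactor_rightRegular_eq_self_of_isHolOrAntihol L ι H T hT P hP) ξ hmem τ)

/-- **«QPSI» ⟹ PIN-τ** as the ★ (K1) letter `S2PinCompactLetter` (= the LH1 leaf's `S2PinCompactLetter`, `Iff.rfl`): §2 at the embeddings off the place of `ι`;
the letter's `K_c`-triviality binder and its `mk τ ≠ mk ι` guard are not needed. [cite: Marshall2014, §3.3; §4.1] [cite: Rogawski1990, §14.6 pp. 242–243; §12.3 pp. 176, 178] -/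
theorem pinCompact_of_qpsi
    (hQ : ∀ (L : Type) [Field L] [NumberField L] [IsCMField L] (ι : L →+* ℂ) (H : Matrix (Fin 3) (Fin 3) L) (T : GL (Fin 3) ℂ)
      (hT : (T : Matrix (Fin 3) (Fin 3) ℂ)ᴴ * H.map ι * (T : Matrix (Fin 3) (Fin 3) ℂ) = Literature.Geometry.ComplexHyperbolic.BallModel.J),
      (∀ τ' : L →+* ℂ, InfinitePlace.mk τ' ≠ InfinitePlace.mk ι → (H.map τ').PosDef) →
      2 ≤ Module.finrank ℚ ↥(maximalRealSubfield L) →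
      ∀ (μ : Measure (adelicGroupData (↥(maximalRealSubfield L)) L (IsCMField.complexConj L) 3 H).automorphicQuotient)
        [(adelicGroupData (↥(maximalRealSubfield L)) L (IsCMField.complexConj L) 3 H).IsAutomorphicMeasure μ]
        (μω : HeckeCharacter L) (hμu : μω.IsUnitary),
        (∀ x : Literature.NumberTheory.GaloisRepresentations.ideleGroup ↥(maximalRealSubfield L),
          μω (AdeleRing.ideleBaseChange (↥(maximalRealSubfield L)) L x) = quadraticHeckeCharCM L x) →
      ∀ (P : DiscreteAutomorphicRep (adelicGroupData (↥(maximalRealSubfield L)) L (IsCMField.complexConj L) 3 H) μ),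
        (P.IsHolCotangentAt (cmArchSection L ι H T hT) (cmCompactFactor L ι H T hT) ∨
          P.IsAntiholCotangentAt (cmArchSection L ι H T hT) (cmCompactFactor L ι H T hT)) →
        (∀ k : (adelicGroupData (↥(maximalRealSubfield L)) L (IsCMField.complexConj L) 3 H).Adelic, k ∈ cmCompactFactor L ι H T hT →
          ∀ v : P.space.toSubmodule, (adelicGroupData (↥(maximalRealSubfield L)) L (IsCMField.complexConj L) 3 H).rightRegular μ k
            (v : (adelicGroupData (↥(maximalRealSubfield L)) L (IsCMField.complexConj L) 3 H).L2 μ) = v) →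
        ∀ ξ : OneDimAutRepH L,
          MemXiFamily P (transpose_map_cmConjRingHom_eq_of_frame L ι H T hT) (isUnit_det_of_frame L ι H T hT) μω hμu ξ →
            ∀ τ : L →+* ℂ, ξ.qψ τ = 1 ∨ ξ.qψ τ = -1) :
    S2PinCompactLetter :=
  fun L _ _ _ ι H T hT hdef h2 μ _ μω hμu hμω P hP _ ξ hmem τ _ =>
    isCohTrivialAt_of_qpsi hQ L ι H T hT hdef h2 μ μω hμu hμω P hP ξ hmem τ

/-- **«QPSI» ⟹ CASIMIR-τ** as the ★ (K1) letter `S2CasimirTauLetter` (= the LH1 leaf ED. 4's organ `S2CasimirTauLetter`, `Iff.rfl`) — so the leaf heir may write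
`stub_S2casimirTau := casimirTau_of_qpsi stub_S2qpsi`. [cite: Marshall2014, §3.3; §4.1] [cite: Rogawski1990, §14.6 pp. 242–243; §12.3 pp. 176, 178] -/
theorem casimirTau_of_qpsi
    (hQ : ∀ (L : Type) [Field L] [NumberField L] [IsCMField L] (ι : L →+* ℂ) (H : Matrix (Fin 3) (Fin 3) L) (T : GL (Fin 3) ℂ)
      (hT : (T : Matrix (Fin 3) (Fin 3) ℂ)ᴴ * H.map ι * (T : Matrix (Fin 3) (Fin 3) ℂ) = Literature.Geometry.ComplexHyperbolic.BallModel.J),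
      (∀ τ' : L →+* ℂ, InfinitePlace.mk τ' ≠ InfinitePlace.mk ι → (H.map τ').PosDef) →
      2 ≤ Module.finrank ℚ ↥(maximalRealSubfield L) →
      ∀ (μ : Measure (adelicGroupData (↥(maximalRealSubfield L)) L (IsCMField.complexConj L) 3 H).automorphicQuotient)
        [(adelicGroupData (↥(maximalRealSubfield L)) L (IsCMField.complexConj L) 3 H).IsAutomorphicMeasure μ]
        (μω : HeckeCharacter L) (hμu : μω.IsUnitary),
        (∀ x : Literature.NumberTheory.GaloisRepresentations.ideleGroup ↥(maximalRealSubfield L),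
          μω (AdeleRing.ideleBaseChange (↥(maximalRealSubfield L)) L x) = quadraticHeckeCharCM L x) →
      ∀ (P : DiscreteAutomorphicRep (adelicGroupData (↥(maximalRealSubfield L)) L (IsCMField.complexConj L) 3 H) μ),
        (P.IsHolCotangentAt (cmArchSection L ι H T hT) (cmCompactFactor L ι H T hT) ∨
          P.IsAntiholCotangentAt (cmArchSection L ι H T hT) (cmCompactFactor L ι H T hT)) →
        (∀ k : (adelicGroupData (↥(maximalRealSubfield L)) L (IsCMField.complexConj L) 3 H).Adelic, k ∈ cmCompactFactor L ι H T hT →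
          ∀ v : P.space.toSubmodule, (adelicGroupData (↥(maximalRealSubfield L)) L (IsCMField.complexConj L) 3 H).rightRegular μ k
            (v : (adelicGroupData (↥(maximalRealSubfield L)) L (IsCMField.complexConj L) 3 H).L2 μ) = v) →
        ∀ ξ : OneDimAutRepH L,
          MemXiFamily P (transpose_map_cmConjRingHom_eq_of_frame L ι H T hT) (isUnit_det_of_frame L ι H T hT) μω hμu ξ →
            ∀ τ : L →+* ℂ, ξ.qψ τ = 1 ∨ ξ.qψ τ = -1) :
    S2CasimirTauLetter :=
  fun L _ _ _ ι H T hT hdef h2 μ _ μω hμu hμω P hP _ ξ hmem τ _ a b c habc =>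
    sq_sum_eq_two_of_qpsi hQ L ι H T hT hdef h2 μ μω hμu hμω P hP ξ hmem τ a b c habc

/-! ## §3 S2♭ (#70) ∧ «QPSI» ⟹ S2♯ (#80): the archimedean half of #80 is exactly the printed sentence -/

/-- **S2♭ ∧ «QPSI» ⟹ S2♯** (the ED. 5 head, in books currency): the `ξ` of S2♭ (★ letter `cohDiscrete_memXiFamily`, #70 — FIN is its restriction to the S2♯ frame);
for a unitary type `k` of `μω`, `k = k₀` (★ `archTypeOfRecord_eq`), and the pin at every `ι′` is §2's `isCohTrivialAt_of_qpsi`.  No token∕Casimir∕centre bookkeeping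
at `ι` is needed any more (compare ED. 3∕4's head through GLOBAL-ι^χ): «QPSI» + ★ CENTRAL carry the whole archimedean pin.
[cite: Marshall2014, §3.3; §3.4; §4.1] [cite: Rogawski1990, §14.6 Thm. 14.6.4 (p. 243); §15.3 ¶1 (p. 249); Thm. 13.3.6 (c) (p. 202); §12.3 pp. 174–178] [cite: Liu2021, Remark 4.2] -/
theorem s2sharp_of_S2flat_qpsi (hFlat : Literature.NumberTheory.Rogawski1990.cohDiscrete_memXiFamily)
    (hQ : ∀ (L : Type) [Field L] [NumberField L] [IsCMField L] (ι : L →+* ℂ) (H : Matrix (Fin 3) (Fin 3) L) (T : GL (Fin 3) ℂ)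
      (hT : (T : Matrix (Fin 3) (Fin 3) ℂ)ᴴ * H.map ι * (T : Matrix (Fin 3) (Fin 3) ℂ) = Literature.Geometry.ComplexHyperbolic.BallModel.J),
      (∀ τ' : L →+* ℂ, InfinitePlace.mk τ' ≠ InfinitePlace.mk ι → (H.map τ').PosDef) →
      2 ≤ Module.finrank ℚ ↥(maximalRealSubfield L) →
      ∀ (μ : Measure (adelicGroupData (↥(maximalRealSubfield L)) L (IsCMField.complexConj L) 3 H).automorphicQuotient)
        [(adelicGroupData (↥(maximalRealSubfield L)) L (IsCMField.complexConj L) 3 H).IsAutomorphicMeasure μ]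
        (μω : HeckeCharacter L) (hμu : μω.IsUnitary),
        (∀ x : Literature.NumberTheory.GaloisRepresentations.ideleGroup ↥(maximalRealSubfield L),
          μω (AdeleRing.ideleBaseChange (↥(maximalRealSubfield L)) L x) = quadraticHeckeCharCM L x) →
      ∀ (P : DiscreteAutomorphicRep (adelicGroupData (↥(maximalRealSubfield L)) L (IsCMField.complexConj L) 3 H) μ),
        (P.IsHolCotangentAt (cmArchSection L ι H T hT) (cmCompactFactor L ι H T hT) ∨
          P.IsAntiholCotangentAt (cmArchSection L ι H T hT) (cmCompactFactor L ι H T hT)) →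
        (∀ k : (adelicGroupData (↥(maximalRealSubfield L)) L (IsCMField.complexConj L) 3 H).Adelic, k ∈ cmCompactFactor L ι H T hT →
          ∀ v : P.space.toSubmodule, (adelicGroupData (↥(maximalRealSubfield L)) L (IsCMField.complexConj L) 3 H).rightRegular μ k
            (v : (adelicGroupData (↥(maximalRealSubfield L)) L (IsCMField.complexConj L) 3 H).L2 μ) = v) →
        ∀ ξ : OneDimAutRepH L,
          MemXiFamily P (transpose_map_cmConjRingHom_eq_of_frame L ι H T hT) (isUnit_det_of_frame L ι H T hT) μω hμu ξ →
            ∀ τ : L →+* ℂ, ξ.qψ τ = 1 ∨ ξ.qψ τ = -1) :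
    Literature.NumberTheory.Rogawski1990.cohDiscrete_memXiFamily_archPinned := by
  intro L _ _ _ ι H T hT hdef h2 μ _ μω hμu hμω P hP _ M _ _ σK σ𝔤 hM hirr htok δ hδ hne
  obtain ⟨ξ, hmem⟩ := hFlat L ι H T hT hdef h2 μ μω hμu hμω P M σK σ𝔤 hM hirr htok δ hδ hne
  refine ⟨ξ, hmem, fun k hk ι' => ?_⟩
  rw [← archTypeOfRecord_eq hμu hk]
  exact isCohTrivialAt_of_qpsi hQ L ι H T hT hdef h2 μ μω hμu hμω P hP ξ hmem ι'

end Summit.HodgeConjecture.HodgeConjecture.Cruxes.H413.F0P3cS2SharpQpsi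

end
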